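import Mathlib.Analysis.Calculus.MeanValue
import Mathlib.Analysis.SpecialFunctions.Pow.Real
import Mathlib.Analysis.SpecialFunctions.Sqrt
import Mathlib.Analysis.SpecialFunctions.ExpDeriv
import HarnessLib

/-!
# Small-data exponential decay for the damped superlinear differential inequality `y' ≤ C y^{3/2} − α y`

Analysis/ODE proof file (theorems only). The scalar comparison step behind every «Lyapunov functional with
cubic production and linear dissipation» small-data argument (e.g. the enstrophy inequality
`ℰ' ≤ cℰ³ − νλ₁ℰ` after a change of unknown, or functionals `E' ≤ C E^{3/2} − αE` as in claimed regularity
proofs adjudicated by the cell `ns-claims`, D-0090): if `y ≥ 0` is continuous on `[0,b]` with right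
derivative `y'`, `y' ≤ C y √y − α y` on `[0,b)`, `α > 0`, `C ≥ 0`, and `C √(y(0)) < α/2`, then
`y(t) ≤ y(0) e^{−αt/2}` on `[0,b]`. Proof: Mathlib's fencing theorem
(`image_le_of_deriv_right_lt_deriv_boundary`) against the barriers `(y(0)+ε) e^{−αt/2}`, `ε ↓ 0`: at a
touching point `C√y < α/2`, so `y' ≤ y(C√y − α) < −(α/2) y`. Standard (e.g. Temam 1997, Ch. III Lemma 1.1
type arguments; Robinson–Rodrigo–Sadowski 2016, proof of Thm 6.12).

* `le_mul_exp_of_deriv_le_mul_sqrt_sub` — the `y √y` form;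
* `le_mul_exp_of_deriv_le_rpow_sub` — the `y^{3/2}` (`Real.rpow`) form.

WHAT THIS IS NOT: not a claim about NS regularity or blow-up; not a claim about any author beyond the
typed locator.
-/

noncomputable section

open Set Filter Topology Real

namespace Literature.Analysis.ODE

/-- **Small-data decay for `y' ≤ C y√y − α y`** (fencing against `(y₀+ε)e^{−αt/2}`): for `α > 0`, `C ≥ 0`,
`y ≥ 0` continuous on `[0,b]` with right derivatives `y'` on `[0,b)` satisfying
`y' ≤ C y √y − α y`, and `C √(y 0) < α/2`, one has `y t ≤ y 0 · e^{−(α/2)t}` on `[0,b]`.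
[cite: RobinsonRodrigoSadowskiCUP2016, proof of Thm 6.12 (p. 108)] -/
theorem le_mul_exp_of_deriv_le_mul_sqrt_sub {y y' : ℝ → ℝ} {C α b : ℝ} (hα : 0 < α) (hC : 0 ≤ C)
    (hy : ContinuousOn y (Icc 0 b)) (hy' : ∀ t ∈ Ico 0 b, HasDerivWithinAt y (y' t) (Ici t) t)
    (hnn : ∀ t ∈ Icc 0 b, 0 ≤ y t)
    (hineq : ∀ t ∈ Ico 0 b, y' t ≤ C * y t * Real.sqrt (y t) - α * y t)
    (hsmall : C * Real.sqrt (y 0) < α / 2) :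
    ∀ t ∈ Icc 0 b, y t ≤ y 0 * Real.exp (-(α / 2) * t) := by
  intro t ht
  have hy0 : 0 ≤ y 0 := hnn 0 ⟨le_rfl, ht.1.trans ht.2⟩
  -- the barrier inequality for every small `ε > 0`
  have hε : ∀ᶠ ε in 𝓝[>] (0 : ℝ), y t ≤ (y 0 + ε) * Real.exp (-(α / 2) * t) := by
    -- `C √(y0 + ε) < α/2` for small `ε`
    have hcont : ContinuousAt (fun ε : ℝ => C * Real.sqrt (y 0 + ε)) 0 :=
      (continuous_const.mul ((continuous_const.add continuous_id).sqrt)).continuousAt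
    have hlt : ∀ᶠ ε in 𝓝 (0 : ℝ), C * Real.sqrt (y 0 + ε) < α / 2 := by
      refine hcont.eventually (gt_mem_nhds ?_)
      simpa using hsmall
    have hpos : ∀ᶠ ε in 𝓝[>] (0 : ℝ), 0 < ε := eventually_mem_nhdsWithin
    filter_upwards [nhdsWithin_le_nhds hlt, hpos] with ε hε hεpos
    -- fencing against `B s = (y0 + ε) e^{-(α/2) s}`
    set B : ℝ → ℝ := fun s => (y 0 + ε) * Real.exp (-(α / 2) * s) with hB
    set B' : ℝ → ℝ := fun s => (y 0 + ε) * (Real.exp (-(α / 2) * s) * (-(α / 2))) with hB'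
    have hBd : ∀ s, HasDerivAt B (B' s) s := fun s => by
      have h := ((hasDerivAt_id s).const_mul (-(α / 2))).exp.const_mul (y 0 + ε)
      simp only [mul_one, id] at h
      exact h
    have h0 : y 0 ≤ B 0 := by
      simp only [hB, mul_zero, Real.exp_zero, mul_one]
      linarith
    have hbound : ∀ s ∈ Ico 0 b, y s = B s → y' s < B' s := by
      intro s hs hsB
      have hBs : 0 < B s := by
        simp only [hB]
        exact mul_pos (by linarith) (Real.exp_pos _)
      have hys : 0 < y s := hsB ▸ hBs
      -- `√(y s) ≤ √(y0 + ε)` since `B s ≤ y0 + ε`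
      have hle : y s ≤ y 0 + ε := by
        rw [hsB]
        simp only [hB]
        have hexp : Real.exp (-(α / 2) * s) ≤ 1 := by
          rw [Real.exp_le_one_iff]
          nlinarith [hs.1]
        nlinarith [Real.exp_pos (-(α / 2) * s)]
      have hsq : C * Real.sqrt (y s) < α / 2 :=
        (mul_le_mul_of_nonneg_left (Real.sqrt_le_sqrt hle) hC).trans_lt hε
      have h1 : y' s ≤ C * y s * Real.sqrt (y s) - α * y s := hineq s hs
      have h2 : C * y s * Real.sqrt (y s) - α * y s < -(α / 2) * y s := by
        have : C * y s * Real.sqrt (y s) = y s * (C * Real.sqrt (y s)) := by ring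
        rw [this]
        nlinarith
      have h3 : B' s = -(α / 2) * y s := by
        simp only [hB']
        rw [hsB]
        simp only [hB]
        ring
      rw [h3]
      exact h1.trans_lt h2
    exact image_le_of_deriv_right_lt_deriv_boundary hy hy' h0 hBd hbound ht
  -- let `ε → 0⁺`
  have hlim : Tendsto (fun ε : ℝ => (y 0 + ε) * Real.exp (-(α / 2) * t)) (𝓝[>] (0 : ℝ))
      (𝓝 ((y 0 + 0) * Real.exp (-(α / 2) * t))) :=
    ((tendsto_const_nhds.add tendsto_id).mul tendsto_const_nhds).mono_left nhdsWithin_le_nhds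
  rw [add_zero] at hlim
  exact ge_of_tendsto hlim hε

/-- The same with the production term written as `C y^{3/2}` (`Real.rpow`).
[cite: RobinsonRodrigoSadowskiCUP2016, proof of Thm 6.12 (p. 108)] -/
theorem le_mul_exp_of_deriv_le_rpow_sub {y y' : ℝ → ℝ} {C α b : ℝ} (hα : 0 < α) (hC : 0 ≤ C)
    (hy : ContinuousOn y (Icc 0 b)) (hy' : ∀ t ∈ Ico 0 b, HasDerivWithinAt y (y' t) (Ici t) t)
    (hnn : ∀ t ∈ Icc 0 b, 0 ≤ y t)
    (hineq : ∀ t ∈ Ico 0 b, y' t ≤ C * y t ^ (3 / 2 : ℝ) - α * y t)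
    (hsmall : C * Real.sqrt (y 0) < α / 2) :
    ∀ t ∈ Icc 0 b, y t ≤ y 0 * Real.exp (-(α / 2) * t) := by
  refine le_mul_exp_of_deriv_le_mul_sqrt_sub hα hC hy hy' hnn (fun t ht => ?_) hsmall
  have h0 : 0 ≤ y t := hnn t (Ico_subset_Icc_self ht)
  have h32 : y t ^ (3 / 2 : ℝ) = y t * Real.sqrt (y t) := by
    rw [Real.sqrt_eq_rpow, show (3 / 2 : ℝ) = 1 + 1 / 2 by norm_num,
      Real.rpow_add' h0 (by norm_num), Real.rpow_one]
  have := hineq t ht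
  rw [h32] at this
  linarith

end Literature.Analysis.ODE
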